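import Summits.AtomisticToContinuum.BoseEinsteinCondensation.Theses.BECRewardDescent
import Summits.AtomisticToContinuum.BoseEinsteinCondensation.Theorems.BECRewardDescentRewardScaleChordStubRewardUpper
import Summits.AtomisticToContinuum.BoseEinsteinCondensation.Theorems.BECRewardDescentRewardScaleChordStubEnergyLower

/-!
# Birth skeleton (BC3) for the crux `RewardScaleChord` (stmt-AtomisticToContinuum-12877)

Route `BECRewardDescent` (rank-5 crux, RUNG 1 of the reward walk; wanted by this route only);
planner skeleton `Lines/birth.lean` (planner-skel-stmt-AtomisticToContinuum-12877-0, 2026-08-17).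

**The crux.** `RewardScaleChord`: for every repulsive finite-range `v` and all `τ, θ > 0` there is
`ρ₀ > 0` such that for `0 < ρ < ρ₀`, eventually in `N` (torus of side `L = (N/ρ)^{1/3}`), and
every reward `s > 0` with `s ≥ θρa` (`a` = scattering length):
`R(s) := inf_Ψ (⟨Ψ,HΨ⟩ + s·(N − ⟨Ψ,n̂₀Ψ⟩)) ≤ E₀^per(N,L) + sτN`.

**The line (two named stubs = the two sides of the chord estimate).** The route's own proof
sketch (grounder g27-17 / refuter rreview-0815: "3-line chord estimate") has exactly two
analytic inputs, which the skeleton names: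

* `stub_rewardUpper` — TRIAL-STATE SIDE (reward form of the condensed trial state): for every
  `η > 0`, at small density and eventually in `N`, for every reward `s ≥ 0`,
  `R(s) ≤ 4πaρ(1+η)N + sηN`. Expected proof: evaluate `F_s` at the state `Φ` of the PROVED
  support `CondensedTrialState` (`condensedTrialState_proof`: `⟨Φ,HΦ⟩ ≤ 4πaρ(1+η)N`,
  `n₀(Φ) ≥ (1−η)N`), `R(s) ≤ F_s(Φ)` by `iInf_le`, and `N − n₀(Φ) ≤ ηN` in `ℝ≥0∞`
  (`ENNReal.ofReal_sub`, `tsub_le_iff`; for `η > 1` the bound `N − n₀ ≤ N ≤ ηN` is trivial).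
* `stub_energyLower` — ENERGY SIDE (thermodynamic-limit form of LSSY Thm 2.4): for every `ε > 0`,
  at small density and eventually in `N`, `E₀^per(N,(N/ρ)^{1/3}) ≥ 4πaρ(1−ε)N`. Expected proof:
  the PROVED fact `LSSY2005_lowerBound_periodic_holds` (`E₀/N ≥ 4πρa(1 − C Y^{1/17})`,
  `Y = 4πρa³/3 < δ`, `L/a > C'Y^{-6/17}`) with `a ≠ ⊤` (`ScatteringLengthFinite_holds`),
  `N/L³ = ρ` for `L = (N/ρ)^{1/3}` (`Real.rpow_natCast`, `Real.rpow_mul`), `C Y^{1/17} ≤ ε` and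
  `Y < δ` for `ρ < ρ₀(v, ε)`, and `C'Y^{-6/17} < L/a` eventually (`tendsto_sideLength_atTop`);
  at `a = 0` the left side is `ofReal 0 = 0`.

`RewardScaleChord_of : RewardScaleChord` is PROVED below from the two stubs USED BY NAME (lead
reshape 2026-08-17, cycle 1: the stubs now carry their expanded signatures verbatim — the text the
`--supports` stub files prove — instead of the `Sig.*` abbreviations, and `stub_rewardUpper` is
stated with `sideLength ρ N` substituted for the crux's `let L := …` (zeta-equal; a `:=` inside a
registered signature defeats the stub matcher), so that the stub registry matches the landed
headers; the mathematics and the composition are unchanged, no sorry outside the two stubs): with `η = ε := min(1/2, τ/2, θτ/16π)` (lemma `exists_small`), for `s ≥ θρa`,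
`4πaρ(1+η)N + sηN = 4πaρ(1−η)N + (8πaρη + sη)N ≤ E₀ + sτN` because `8πaρη ≤ 8πηs/θ ≤ τs/2` and
`sη ≤ τs/2`; the `ℝ≥0∞` step is `ofReal_add` twice + `add_le_add`.

Neither stub is the crux or the summit in disguise: `stub_rewardUpper` alone does not control
`E₀^per` from below (it is compatible with `E₀^per = 0`), `stub_energyLower` alone says nothing
about the reward functional; the BC3 probes (`stub → RewardScaleChord`, `stub →
BoseEinsteinCondensation` by `first | exact? | simpa | aesop`) all fail (table in `birth.md`).

Disproof used: none on file (no `Disproof.lean` in `Cruxes/RewardScaleChord/` at registration,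
`ledger crux ls` = no workfiles). Honoured: the refuter's read-back (rattack-12877: `N − n₀` is a
truncated subtraction but `n₀ ≤ N`; `a = ⊤` impossible for finite range) — `stub_rewardUpper`
keeps the crux's truncated `(N : ℝ≥0∞) − n₀` verbatim and quantifies `s ≥ 0`, and both stubs read
`a := (scatteringLength v).toReal` exactly as the crux does.
-/

open MeasureTheory Filter
open scoped ENNReal

namespace Summit.AtomisticToContinuum.BoseEinsteinCondensation.Cruxes.RewardScaleChord.Birth

open Summit.AtomisticToContinuum.BoseEinsteinCondensation.Theses.BECRewardDescent
open Literature.MathematicalPhysics.QuantumManyBody.BoseGas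

/-! ## Stubs (registered; expanded signatures, used BY NAME in `RewardScaleChord_of`) -/

/-- stub 1 — TRIAL-STATE SIDE (`stub_rewardUpper`): for every `η > 0`, at small density, eventually
in `N`, for every `s ≥ 0`, `R(s) ≤ 4πaρ(1+η)N + sηN` on the torus of side `(N/ρ)^{1/3}` — evaluate
`F_s` at the condensed trial state `Φ` of the proved support `CondensedTrialState`
(`condensedTrialState_proof`), `iInf_le`, and `N − n₀(Φ) ≤ ηN` in `ℝ≥0∞` (size S–M).
Worker file: `Theorems/BECRewardDescentRewardScaleChordStubRewardUpper.lean`. -/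
theorem stub_rewardUpper :
    ∀ v : ℝ → ENNReal, Literature.MathematicalPhysics.QuantumManyBody.BoseGas.IsRepulsiveFiniteRange v → ∀ η : ℝ, 0 < η → ∃ ρ₀ : ℝ, 0 < ρ₀ ∧ ∀ ρ : ℝ, 0 < ρ → ρ < ρ₀ → ∀ᶠ N : ℕ in Filter.atTop, ∀ s : ℝ, 0 ≤ s → (⨅ Ψ : Literature.MathematicalPhysics.QuantumManyBody.BoseGas.PeriodicTrialState N (Literature.MathematicalPhysics.QuantumManyBody.BoseGas.sideLength ρ N), (Literature.MathematicalPhysics.QuantumManyBody.BoseGas.periodicEnergy v Ψ + ENNReal.ofReal s * ((N : ENNReal) - Literature.MathematicalPhysics.QuantumManyBody.BoseGas.condensateOccupation N (Literature.MathematicalPhysics.QuantumManyBody.BoseGas.sideLength ρ N) Ψ.ψ))) ≤ ENNReal.ofReal (4 * Real.pi * (Literature.MathematicalPhysics.QuantumManyBody.BoseGas.scatteringLength v).toReal * ρ * (1 + η) * N) + ENNReal.ofReal (s * η * N) :=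
  -- LANDED (cycle 1, wave 1, p148936): Theorems/BECRewardDescentRewardScaleChordStubRewardUpper.lean
  _root_.Summit.AtomisticToContinuum.BoseEinsteinCondensation.Theorems.RewardScaleChord.stub_rewardUpper

/-- stub 2 — ENERGY SIDE (`stub_energyLower`): for every `ε > 0`, at small density, eventually in
`N`, `E₀^per(N, (N/ρ)^{1/3}) ≥ 4πaρ(1−ε)N` — the thermodynamic-limit reading of the proved
`LSSY2005_lowerBound_periodic_holds` (`N/L³ = ρ` by `sideLength_pow_three`, `Y < δ` and
`C Y^{1/17} ≤ ε` by smallness of `ρ`, `C'Y^{-6/17} a < L` eventually by `tendsto_sideLength_atTop`;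
`a = 0` trivial; size M). Lead file: `Theorems/BECRewardDescentRewardScaleChordStubEnergyLower.lean`. -/
theorem stub_energyLower :
    ∀ v : ℝ → ENNReal, Literature.MathematicalPhysics.QuantumManyBody.BoseGas.IsRepulsiveFiniteRange v → ∀ ε : ℝ, 0 < ε → ∃ ρ₀ : ℝ, 0 < ρ₀ ∧ ∀ ρ : ℝ, 0 < ρ → ρ < ρ₀ → ∀ᶠ N : ℕ in Filter.atTop, ENNReal.ofReal (4 * Real.pi * (Literature.MathematicalPhysics.QuantumManyBody.BoseGas.scatteringLength v).toReal * ρ * (1 - ε) * N) ≤ Literature.MathematicalPhysics.QuantumManyBody.BoseGas.periodicGroundStateEnergy v N (Literature.MathematicalPhysics.QuantumManyBody.BoseGas.sideLength ρ N) :=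
  -- LANDED (cycle 1, lead, p148964): Theorems/BECRewardDescentRewardScaleChordStubEnergyLower.lean
  _root_.Summit.AtomisticToContinuum.BoseEinsteinCondensation.Theorems.RewardScaleChord.stub_energyLower

/-! ## The glue -/

/-- The small parameter of the chord estimate: `η ≤ 1/2`, `η ≤ τ/2`, `16πη ≤ θτ`. -/
theorem exists_small (τ θ : ℝ) (hτ : 0 < τ) (hθ : 0 < θ) :
    ∃ η : ℝ, 0 < η ∧ η ≤ 1 / 2 ∧ η ≤ τ / 2 ∧ η * (16 * Real.pi) ≤ θ * τ := by
  have hπ : 0 < 16 * Real.pi := by positivity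
  refine ⟨min (1 / 2) (min (τ / 2) (θ * τ / (16 * Real.pi))), ?_, min_le_left _ _, ?_, ?_⟩
  · exact lt_min (by norm_num) (lt_min (by positivity) (by positivity))
  · exact (min_le_right _ _).trans (min_le_left _ _)
  · calc min (1 / 2) (min (τ / 2) (θ * τ / (16 * Real.pi))) * (16 * Real.pi)
        ≤ (θ * τ / (16 * Real.pi)) * (16 * Real.pi) :=
          mul_le_mul_of_nonneg_right ((min_le_right _ _).trans (min_le_right _ _)) hπ.le
      _ = θ * τ := div_mul_cancel₀ _ hπ.ne'

/-- The real-number heart of the chord estimate: for `s ≥ θρa`, `η ≤ τ/2` and `16πη ≤ θτ`,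
`8πaρηN + sηN ≤ sτN` (the signs of `a`, `ρ` are not even needed: they enter only through
`θρa ≤ s`). -/
theorem chord_arith {a ρ s τ θ η N : ℝ} (hs : 0 ≤ s) (hθ : 0 < θ)
    (hη : 0 ≤ η) (hN : 0 ≤ N) (hη2 : η ≤ τ / 2) (h16 : η * (16 * Real.pi) ≤ θ * τ)
    (hθs : θ * ρ * a ≤ s) :
    8 * Real.pi * a * ρ * η * N + s * η * N ≤ s * τ * N := by
  have hπ : 0 < Real.pi := Real.pi_pos
  -- 8πaρη ≤ sτ/2, proved after multiplying by θ > 0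
  have hst : θ * (8 * Real.pi * a * ρ * η) ≤ θ * (s * τ / 2) := by
    have e1 : θ * (8 * Real.pi * a * ρ * η) = (8 * Real.pi * η) * (θ * ρ * a) := by ring
    have e2 : θ * (s * τ / 2) = (θ * τ) * s / 2 := by ring
    rw [e1, e2]
    have i1 : (8 * Real.pi * η) * (θ * ρ * a) ≤ (8 * Real.pi * η) * s :=
      mul_le_mul_of_nonneg_left hθs (by positivity)
    have i2 : (8 * Real.pi * η) * s ≤ (θ * τ) * s / 2 := by
      have e3 : (8 * Real.pi * η) * s = (η * (16 * Real.pi)) * s / 2 := by ring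
      rw [e3]
      have := mul_le_mul_of_nonneg_right h16 hs
      linarith
    exact i1.trans i2
  have h8 : 8 * Real.pi * a * ρ * η ≤ s * τ / 2 := le_of_mul_le_mul_left hst hθ
  have h9 : s * η ≤ s * (τ / 2) := mul_le_mul_of_nonneg_left hη2 hs
  have h10 : 8 * Real.pi * a * ρ * η * N ≤ s * τ / 2 * N := mul_le_mul_of_nonneg_right h8 hN
  have h11 : s * η * N ≤ s * (τ / 2) * N := mul_le_mul_of_nonneg_right h9 hN
  have e4 : s * τ / 2 * N + s * (τ / 2) * N = s * τ * N := by ring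
  linarith

/-- **Composition (kernel-checked, no sorry of its own).** The crux BY NAME from the two stubs
used BY NAME:
`R(s) ≤ 4πaρ(1+η)N + sηN = 4πaρ(1−η)N + (8πaρη + sη)N ≤ E₀^per + sτN` for `s ≥ θρa`,
with `η = ε` from `exists_small`. -/
theorem RewardScaleChord_of : RewardScaleChord := by
  intro v hv τ θ hτ hθ
  have hπ : 0 < Real.pi := Real.pi_pos
  obtain ⟨η, hη, hη1, hη2, h16⟩ := exists_small τ θ hτ hθ
  obtain ⟨ρ₁, hρ₁, hU⟩ := stub_rewardUpper v hv η hη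
  obtain ⟨ρ₂, hρ₂, hE⟩ := stub_energyLower v hv η hη
  refine ⟨min ρ₁ ρ₂, lt_min hρ₁ hρ₂, fun ρ hρ hρlt => ?_⟩
  have h1 : ρ < ρ₁ := lt_of_lt_of_le hρlt (min_le_left _ _)
  have h2 : ρ < ρ₂ := lt_of_lt_of_le hρlt (min_le_right _ _)
  filter_upwards [hU ρ hρ h1, hE ρ hρ h2] with N hUN hEN
  intro s hs hθs
  dsimp only
  have hu := hUN s hs.le
  set a : ℝ := (Literature.MathematicalPhysics.QuantumManyBody.BoseGas.scatteringLength v).toReal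
    with ha_def
  have ha : 0 ≤ a := ENNReal.toReal_nonneg
  have hN : (0 : ℝ) ≤ N := N.cast_nonneg
  have h4π : (0 : ℝ) ≤ 4 * Real.pi := by positivity
  have h1η : (0 : ℝ) ≤ 1 - η := by linarith
  have h1η' : (0 : ℝ) ≤ 1 + η := by linarith
  -- nonnegativity of the four real summands
  have hP : 0 ≤ 4 * Real.pi * a * ρ * (1 + η) * N :=
    mul_nonneg (mul_nonneg (mul_nonneg (mul_nonneg h4π ha) hρ.le) h1η') hN
  have hQ : 0 ≤ s * η * N := mul_nonneg (mul_nonneg hs.le hη.le) hN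
  have hA : 0 ≤ 4 * Real.pi * a * ρ * (1 - η) * N :=
    mul_nonneg (mul_nonneg (mul_nonneg (mul_nonneg h4π ha) hρ.le) h1η) hN
  have hB : 0 ≤ 8 * Real.pi * a * ρ * η * N + s * η * N := by
    have : 0 ≤ 8 * Real.pi * a * ρ * η * N :=
      mul_nonneg (mul_nonneg (mul_nonneg (mul_nonneg (by positivity) ha) hρ.le) hη.le) hN
    exact add_nonneg this hQ
  have hsplit : 4 * Real.pi * a * ρ * (1 + η) * N + s * η * N
      = 4 * Real.pi * a * ρ * (1 - η) * N + (8 * Real.pi * a * ρ * η * N + s * η * N) := by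
    ring
  have hkey : 8 * Real.pi * a * ρ * η * N + s * η * N ≤ s * τ * N :=
    chord_arith hs.le hθ hη.le hN hη2 h16 hθs
  refine hu.trans ?_
  rw [← ENNReal.ofReal_add hP hQ, hsplit, ENNReal.ofReal_add hA hB]
  exact add_le_add hEN (ENNReal.ofReal_le_ofReal hkey)

end Summit.AtomisticToContinuum.BoseEinsteinCondensation.Cruxes.RewardScaleChord.Birth
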